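import Summits.Ventures.AbcSig.Rows.Bridge
import Summits.Ventures.AbcSig.Rows.C2aL19A1V2
import Summits.Ventures.AbcSig.Rows.C2aL19A1V2AB

/-!
# Venture AbcSig — CELL `C2aL19A1V2`: the census statement `Rows.C2aCellRed 19 (fun a => a = 1) ∅` from the two row theorems

HONEST FRAMING. COMPUTATION cell `pub-abcsig`; CONDITIONAL theorem; no claim on ABC or any summit. Hypotheses exactly as in
`Rows/C2aL19A1V2.lean` and `Rows/C2aL19A1V2AB.lean`: `BS04Package` (CITED), `DataComplete` / `RefinesCPSymAll` (COMPUTED level files; norm-form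
certificates at 2432), and the rows' per-orbit CITED exclusions for BOTH family predicates
(`famB` = suffix `_d1`, `famAB` = `_d2`) universally quantified in the exponent. Conclusion = p1's census predicate
(`Rows/Statements.lean`) with the residual of the v2 row of record `census/rows/T-BS13/C2a-l19-a1.md` (sha16 `924c604716b4fdbd`):
all four coprime distributions `A·B = 2·19^m`, reduced exponents. GENERATED by p-lean g4 `gen4/c2arow.py` (pattern of `Rows/C2aL19A1Cell.lean`).
-/

namespace Summit.Ventures.AbcSig

/-- Cell `C2aL19A1V2`: `Rows.C2aCellRed 19 (fun a => a = 1) ∅` under the rows' hypotheses. -/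
theorem xcell_C2aL19A1V2 (M : NewformModel) (hP : M.BS04Package)
    (hD38 : M.DataComplete 38 level38Orbits)
    (hD2432 : M.DataComplete 2432 level2432Orbits)
    (hX_orbit_2432_21_d1 : ∀ n m : ℕ, n ∈ ([11] : List ℕ) → M.Excludes 2432 orbit_2432_21 (famB (2 ^ 1 * 19 ^ m) n (fun _ _ => True)))
    (hX_orbit_2432_22_d1 : ∀ n m : ℕ, n ∈ ([11] : List ℕ) → M.Excludes 2432 orbit_2432_22 (famB (2 ^ 1 * 19 ^ m) n (fun _ _ => True)))
    (hX_orbit_2432_23_d1 : ∀ n m : ℕ, n ∈ ([11] : List ℕ) → M.Excludes 2432 orbit_2432_23 (famB (2 ^ 1 * 19 ^ m) n (fun _ _ => True)))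
    (hX_orbit_2432_24_d1 : ∀ n m : ℕ, n ∈ ([11] : List ℕ) → M.Excludes 2432 orbit_2432_24 (famB (2 ^ 1 * 19 ^ m) n (fun _ _ => True)))
    (hX_orbit_2432_21_d2 : ∀ n m : ℕ, n ∈ ([11] : List ℕ) → M.Excludes 2432 orbit_2432_21 (famAB (19 ^ m) (2 ^ 1) n (fun _ _ => True)))
    (hX_orbit_2432_22_d2 : ∀ n m : ℕ, n ∈ ([11] : List ℕ) → M.Excludes 2432 orbit_2432_22 (famAB (19 ^ m) (2 ^ 1) n (fun _ _ => True)))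
    (hX_orbit_2432_23_d2 : ∀ n m : ℕ, n ∈ ([11] : List ℕ) → M.Excludes 2432 orbit_2432_23 (famAB (19 ^ m) (2 ^ 1) n (fun _ _ => True)))
    (hX_orbit_2432_24_d2 : ∀ n m : ℕ, n ∈ ([11] : List ℕ) → M.Excludes 2432 orbit_2432_24 (famAB (19 ^ m) (2 ^ 1) n (fun _ _ => True))) :
    Rows.C2aCellRed 19 (fun a => a = 1) ∅ :=
  C2aCellRed_of_rows 19 (by norm_num) (by norm_num) _ _
    (fun n hn h11 hnℓ _ a m (ha : a = 1) han hm hmn x y z h1 h2 => by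
      subst ha
      exact xrow_C2aL19A1V2 M hP  hD38 hD2432 n hn h11 hnℓ  m hm hmn (hX_orbit_2432_21_d1 n m) (hX_orbit_2432_22_d1 n m) (hX_orbit_2432_23_d1 n m) (hX_orbit_2432_24_d1 n m) x y z h1 h2)
    (fun n hn h11 hnℓ _ a m (ha : a = 1) han hm hmn x y z h1 h2 => by
      subst ha
      exact xrow_C2aL19A1V2AB M hP  hD38 hD2432 n hn h11 hnℓ  m hm hmn (hX_orbit_2432_21_d2 n m) (hX_orbit_2432_22_d2 n m) (hX_orbit_2432_23_d2 n m) (hX_orbit_2432_24_d2 n m) x y z h1 h2)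

end Summit.Ventures.AbcSig
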